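import Mathlib
import Literature.Computability.AlgebraicComplexity.PermanentIrreducible
import Summits.ValiantsHypothesis.ValiantsHypothesis.Theses.ForgivenCollisions

/-!
# ValiantsHypothesis / ForgivenCollisions — `OrderedLaw` (immune Nisan flattening)

Route `ForgivenCollisions`, item `stmt-ValiantsHypothesis-11567` (support, rank 9).

For `n = k + l`, `1 ≤ r ≤ k + 1` and every `P ≡ per_(k+l)` modulo the collision ideal `J_r`
(monomials with a tripled line, or with at least `r` doubled lines), the Nisan coefficient matrix
`M_P[a, b] = coeff_P (∏_{t<k} x_{t, a t} · ∏_{t<l} x_{k+t, b t})`, indexed by injections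
`a : Fin k ↪ Fin n`, `b : Fin l ↪ Fin n`, has rank `≥ C(l + r − 1, r − 1)`.

Proof (the immunity lemma of the route thesis, card P2(b)): write `r = m + 1`, fix a
`(k − m)`-set `F` of columns and index rows and columns of a submatrix by the `m`-subsets `B` of
`Fᶜ` (there are `C(l + m, m)` of them): row `B ↦` the increasing enumeration of `F ∪ B`, column
`B' ↦` the increasing enumeration of `(F ∪ B')ᶜ`.  The exponent at `(B, B')` is the graph of the
row-to-column map `Fin.append a b`; every row has degree `1`, every column degree `≤ 2`, and the
doubled columns lie in `B \ B'`, so there are `≤ m < r` of them: the exponent is never in `Bad_r`,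
hence its coefficient in `P` equals its coefficient in `per_n` (dictionary
`MvPolynomial.mem_ideal_span_monomial_image` + `Bad_r` is an upper set), which is `1` iff the map is
a bijection iff `B = B'`.  So the submatrix is an identity matrix of size `C(l + m, m)` and
`Matrix.rank_submatrix_le` finishes.

Sources: Nisan 1991 (rank of the partial-coefficient matrix bounds ABP width); the anticode is the
diametric Erdős–Ko–Rado family (Delsarte 1973); coset frame as in Andrews–Forbes 2022 §1.3.
Everything here is elementary coefficient bookkeeping over tree definitions
(`rowCount`, `colCount`, `perPoly`, `permMonomial` of `PermanentIrreducible.lean`).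
-/

-- the namespace mandated for this Theorems file repeats the component `ValiantsHypothesis`
set_option linter.dupNamespace false

namespace Summit.ValiantsHypothesis.ValiantsHypothesis.Theorems

open MvPolynomial Literature.Computability.AlgebraicComplexity

namespace ForgivenCollisionsOrderedLaw

section Graph

variable {ι : Type*} [Fintype ι] [DecidableEq ι]

/-- The graph exponent `∑_i e_{(i, f i)}` of a row-to-column map `f` takes the value `[f r = c]`
at the cell `(r, c)`. [folklore] -/
theorem graph_apply (f : ι → ι) (r c : ι) :
    (∑ i, Finsupp.single (i, f i) (1 : ℕ)) (r, c) = if f r = c then 1 else 0 := by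
  simp only [Finsupp.coe_finsetSum, Finset.sum_apply, Finsupp.single_apply, Prod.mk.injEq]
  rw [Finset.sum_eq_single r]
  · simp
  · intro i _ hir
    simp [hir]
  · simp

/-- Every row of a graph exponent has degree exactly `1`. [folklore] -/
theorem rowCount_graph (f : ι → ι) (r : ι) :
    rowCount (∑ i, Finsupp.single (i, f i) (1 : ℕ)) r = 1 := by
  simp [rowCount, graph_apply, Finset.sum_ite_eq]

/-- The degree of column `c` in a graph exponent is the size of the fibre of `f` over `c`.
[folklore] -/
theorem colCount_graph (f : ι → ι) (c : ι) :
    colCount (∑ i, Finsupp.single (i, f i) (1 : ℕ)) c =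
      (Finset.univ.filter fun i => f i = c).card := by
  simp only [colCount, graph_apply, Finset.card_filter]

/-- The coefficient of a graph monomial in the permanent is `1` if the row-to-column map is a
bijection (equivalently, injective) and `0` otherwise. [folklore] -/
theorem coeff_graph_perPoly (f : ι → ι) :
    coeff (∑ i, Finsupp.single (i, f i) (1 : ℕ)) (perPoly ι ℂ) =
      if Function.Injective f then 1 else 0 := by
  split_ifs with hf
  · have hb : Function.Bijective f := Finite.injective_iff_bijective.1 hf
    have key : permMonomial (Equiv.ofBijective f hb).symm = ∑ i, Finsupp.single (i, f i) 1 := by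
      ext ⟨r, c⟩
      rw [permMonomial_apply, graph_apply]
      have : ((Equiv.ofBijective f hb).symm c = r) ↔ (f r = c) := by
        rw [Equiv.symm_apply_eq, Equiv.ofBijective_apply]
        exact eq_comm
      simp only [this]
    rw [← key, coeff_permMonomial_perPoly]
  · by_contra hne
    obtain ⟨ρ, hρ⟩ := exists_permMonomial_eq_of_coeff_perPoly_ne_zero ℂ hne
    apply hf
    have hleft : ∀ r, ρ (f r) = r := fun r => by
      have h := DFunLike.congr_fun hρ (r, f r)
      rw [permMonomial_apply, graph_apply, if_pos rfl] at h
      by_contra h'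
      rw [if_neg h'] at h
      exact zero_ne_one h
    intro r r' hrr'
    rw [← hleft r, ← hleft r', hrr']

/-- DICTIONARY, the direction used here: if `P ≡ per` modulo the monomial ideal of `Bad_r`
exponents and `d` has all row and column degrees `≤ 2` and fewer than `r` doubled lines, then
`coeff_d P = coeff_d per` (`Bad_r` is an upper set for divisibility). [folklore] -/
theorem coeff_eq_of_sub_mem_span (r : ℕ) (P : MvPolynomial (ι × ι) ℂ)
    (hP : P - perPoly ι ℂ ∈ Ideal.span ((fun d : ι × ι →₀ ℕ => monomial d (1 : ℂ)) ''
      {d | (∃ i : ι, 3 ≤ rowCount d i) ∨ (∃ j : ι, 3 ≤ colCount d j) ∨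
        r ≤ (Finset.univ.filter fun i : ι => 2 ≤ rowCount d i).card +
          (Finset.univ.filter fun j : ι => 2 ≤ colCount d j).card}))
    (d : ι × ι →₀ ℕ) (hrow : ∀ i, rowCount d i ≤ 2) (hcol : ∀ j, colCount d j ≤ 2)
    (hcard : (Finset.univ.filter fun i : ι => 2 ≤ rowCount d i).card +
          (Finset.univ.filter fun j : ι => 2 ≤ colCount d j).card < r) :
    coeff d P = coeff d (perPoly ι ℂ) := by
  rw [mem_ideal_span_monomial_image] at hP
  by_contra hne
  have hmem : d ∈ (P - perPoly ι ℂ).support := by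
    rw [mem_support_iff, coeff_sub, sub_ne_zero]
    exact hne
  obtain ⟨s, hs, hsd⟩ := hP d hmem
  have hrow' : ∀ i, rowCount s i ≤ rowCount d i := fun i =>
    Finset.sum_le_sum fun c _ => hsd (i, c)
  have hcol' : ∀ j, colCount s j ≤ colCount d j := fun j =>
    Finset.sum_le_sum fun i _ => hsd (i, j)
  rcases hs with ⟨i, hi⟩ | ⟨j, hj⟩ | hr
  · have := (hi.trans (hrow' i)).trans (hrow i)
    omega
  · have := (hj.trans (hcol' j)).trans (hcol j)
    omega
  · have h1 : (Finset.univ.filter fun i : ι => 2 ≤ rowCount s i).card ≤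
        (Finset.univ.filter fun i : ι => 2 ≤ rowCount d i).card := by
      refine Finset.card_le_card fun i => ?_
      simp only [Finset.mem_filter, Finset.mem_univ, true_and]
      exact fun h => h.trans (hrow' i)
    have h2 : (Finset.univ.filter fun j : ι => 2 ≤ colCount s j).card ≤
        (Finset.univ.filter fun j : ι => 2 ≤ colCount d j).card := by
      refine Finset.card_le_card fun j => ?_
      simp only [Finset.mem_filter, Finset.mem_univ, true_and]
      exact fun h => h.trans (hcol' j)
    omega

end Graph

/-- The Nisan exponent of the statement is the graph of the concatenated map `Fin.append a b`.
[folklore] -/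
theorem exponent_eq_graph {k l : ℕ} (a : Fin k → Fin (k + l)) (b : Fin l → Fin (k + l)) :
    ((∑ t : Fin k, Finsupp.single (Fin.castAdd l t, a t) (1 : ℕ)) +
        ∑ t : Fin l, Finsupp.single (Fin.natAdd k t, b t) (1 : ℕ)) =
      ∑ i : Fin (k + l), Finsupp.single (i, Fin.append a b i) (1 : ℕ) := by
  rw [Fin.sum_univ_add]
  simp only [Fin.append_left, Fin.append_right]

/-- The fibre of `Fin.append a b` over `c` splits into the fibres of `a` and of `b`. [folklore] -/
theorem card_fiber_append {k l : ℕ} (a : Fin k → Fin (k + l)) (b : Fin l → Fin (k + l))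
    (c : Fin (k + l)) :
    (Finset.univ.filter fun i : Fin (k + l) => Fin.append a b i = c).card =
      (Finset.univ.filter fun t : Fin k => a t = c).card +
        (Finset.univ.filter fun t : Fin l => b t = c).card := by
  rw [Finset.card_filter, Fin.sum_univ_add]
  simp only [Fin.append_left, Fin.append_right, Finset.card_filter]

/-- An injective map has fibres of size `≤ 1`. [folklore] -/
theorem card_fiber_le_one {k n : ℕ} (a : Fin k ↪ Fin n) (c : Fin n) :
    (Finset.univ.filter fun t : Fin k => a t = c).card ≤ 1 := by
  refine Finset.card_le_one.2 fun x hx y hy => ?_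
  simp only [Finset.mem_filter, Finset.mem_univ, true_and] at hx hy
  exact a.injective (hx.trans hy.symm)

/-- A nonempty fibre of `a` over `c` puts `c` in the range of `a`. [folklore] -/
theorem mem_range_of_card_fiber_pos {k n : ℕ} (a : Fin k → Fin n) (c : Fin n)
    (h : 0 < (Finset.univ.filter fun t : Fin k => a t = c).card) : c ∈ Set.range a := by
  obtain ⟨t, ht⟩ := Finset.card_pos.1 h
  simp only [Finset.mem_filter, Finset.mem_univ, true_and] at ht
  exact ⟨t, ht⟩

end ForgivenCollisionsOrderedLaw

open ForgivenCollisionsOrderedLaw in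
/-- Settles `stmt-ValiantsHypothesis-11567` (`OrderedLaw`, route `ForgivenCollisions`): the
IMMUNE NISAN FLATTENING — for `n = k + l`, `1 ≤ r ≤ k + 1` and `P ≡ per_n mod J_r`, the coefficient
matrix `M_P[a, b]` (`a : Fin k ↪ Fin n` the columns of the first `k` rows, `b : Fin l ↪ Fin n` the
columns of the last `l` rows) has rank `≥ C(l + r − 1, r − 1)`: on the anticode of `k`-sets
containing a fixed `(k − r + 1)`-set, against complements, `M_P` is an identity matrix.
[folklore] -/
theorem orderedLaw_proof :
    Summit.ValiantsHypothesis.ValiantsHypothesis.Theses.ForgivenCollisions.OrderedLaw := by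
  unfold Summit.ValiantsHypothesis.ValiantsHypothesis.Theses.ForgivenCollisions.OrderedLaw
  intro k l r P hr hrk hP
  obtain ⟨m, rfl⟩ : ∃ m, r = m + 1 := ⟨r - 1, by omega⟩
  have hmk : m ≤ k := by omega
  rw [show l + (m + 1) - 1 = l + m by omega, Nat.add_sub_cancel]
  -- the fixed part `F` of the anticode and its complement
  obtain ⟨F, -, hF⟩ := Finset.exists_subset_card_eq
    (s := (Finset.univ : Finset (Fin (k + l)))) (n := k - m) (by simp; omega)
  have hG : Fᶜ.card = l + m := by
    rw [Finset.card_compl, hF, Fintype.card_fin]; omega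
  have hA : ∀ B ∈ Fᶜ.powersetCard m, (F ∪ B).card = k := by
    intro B hB
    rw [Finset.mem_powersetCard] at hB
    rw [Finset.card_union_of_disjoint (Finset.disjoint_left.2 fun x hxF hxB =>
      (Finset.mem_compl.1 (hB.1 hxB)) hxF), hF, hB.2]
    omega
  have hAc : ∀ B ∈ Fᶜ.powersetCard m, ((F ∪ B)ᶜ).card = l := by
    intro B hB
    rw [Finset.card_compl, hA B hB, Fintype.card_fin]
    omega
  -- row and column selections of the submatrix
  set rowSel : (Fᶜ.powersetCard m) → (Fin k ↪ Fin (k + l)) := fun B =>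
    ((F ∪ B.1).orderEmbOfFin (hA B.1 B.2)).toEmbedding with hrowSel
  set colSel : (Fᶜ.powersetCard m) → (Fin l ↪ Fin (k + l)) := fun B =>
    ((F ∪ B.1)ᶜ.orderEmbOfFin (hAc B.1 B.2)).toEmbedding with hcolSel
  have range_rowSel : ∀ B, Set.range (rowSel B) = ↑(F ∪ B.1) := fun B =>
    Finset.range_orderEmbOfFin _ _
  have range_colSel : ∀ B, Set.range (colSel B) = ↑((F ∪ B.1)ᶜ) := fun B =>
    Finset.range_orderEmbOfFin _ _
  -- the entries of the submatrix
  have entry : ∀ B B' : (Fᶜ.powersetCard m),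
      MvPolynomial.coeff ((∑ t : Fin k, Finsupp.single (Fin.castAdd l t, rowSel B t) 1) +
        ∑ t : Fin l, Finsupp.single (Fin.natAdd k t, colSel B' t) 1) P =
      if B = B' then 1 else 0 := by
    intro B B'
    have hB := Finset.mem_powersetCard.1 B.2
    have hB' := Finset.mem_powersetCard.1 B'.2
    rw [exponent_eq_graph]
    -- doubled columns lie in `B \ B'`
    have hdouble : ∀ c, 2 ≤ colCount (∑ i : Fin (k + l),
        Finsupp.single (i, Fin.append (rowSel B) (colSel B') i) (1 : ℕ)) c → c ∈ B.1 := by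
      intro c hc
      rw [colCount_graph, card_fiber_append] at hc
      have h1 := card_fiber_le_one (rowSel B) c
      have h2 := card_fiber_le_one (colSel B') c
      have ha : c ∈ Set.range (rowSel B) := mem_range_of_card_fiber_pos _ c (by omega)
      have hb : c ∈ Set.range (colSel B') := mem_range_of_card_fiber_pos _ c (by omega)
      rw [range_rowSel, Finset.mem_coe, Finset.mem_union] at ha
      rw [range_colSel, Finset.mem_coe, Finset.mem_compl, Finset.mem_union, not_or] at hb
      exact ha.resolve_left hb.1
    rw [coeff_eq_of_sub_mem_span (m + 1) P hP]
    · rw [coeff_graph_perPoly]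
      by_cases hBB : B = B'
      · subst hBB
        rw [if_pos rfl, if_pos]
        refine Fin.append_injective_iff.2
          ⟨(rowSel B).injective, (colSel B).injective, fun i j h => ?_⟩
        have hi : rowSel B i ∈ Set.range (rowSel B) := ⟨i, rfl⟩
        have hj : colSel B j ∈ Set.range (colSel B) := ⟨j, rfl⟩
        rw [range_rowSel, Finset.mem_coe] at hi
        rw [range_colSel, Finset.mem_coe, Finset.mem_compl] at hj
        exact hj (h ▸ hi)
      · rw [if_neg hBB, if_neg]
        intro hinj
        obtain ⟨-, -, hdis⟩ := Fin.append_injective_iff.1 hinj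
        -- `B ≠ B'` of equal size: some `c ∈ B \ B'` is hit by both `a` and `b`
        have hns : ¬ B.1 ⊆ B'.1 := fun hsub =>
          hBB (Subtype.ext (Finset.eq_of_subset_of_card_le hsub (by rw [hB.2, hB'.2])))
        obtain ⟨c, hcB, hcB'⟩ := Finset.not_subset.1 hns
        have hcF : c ∉ F := Finset.mem_compl.1 (hB.1 hcB)
        have ha : c ∈ Set.range (rowSel B) := by
          rw [range_rowSel, Finset.mem_coe, Finset.mem_union]; exact Or.inr hcB
        have hb : c ∈ Set.range (colSel B') := by
          rw [range_colSel, Finset.mem_coe, Finset.mem_compl, Finset.mem_union, not_or]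
          exact ⟨hcF, hcB'⟩
        obtain ⟨i, hi⟩ := ha
        obtain ⟨j, hj⟩ := hb
        exact hdis i j (hi.trans hj.symm)
    · intro i
      rw [rowCount_graph]; omega
    · intro c
      rw [colCount_graph, card_fiber_append]
      exact add_le_add (card_fiber_le_one _ c) (card_fiber_le_one _ c)
    · have hrows : (Finset.univ.filter fun i : Fin (k + l) => 2 ≤ rowCount (∑ i : Fin (k + l),
          Finsupp.single (i, Fin.append (rowSel B) (colSel B') i) (1 : ℕ)) i).card = 0 := by
        rw [Finset.card_eq_zero, Finset.filter_eq_empty_iff]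
        intro i _
        rw [rowCount_graph]; omega
      have hcols : (Finset.univ.filter fun j : Fin (k + l) => 2 ≤ colCount (∑ i : Fin (k + l),
          Finsupp.single (i, Fin.append (rowSel B) (colSel B') i) (1 : ℕ)) j).card ≤ m := by
        rw [← hB.2]
        refine Finset.card_le_card fun c hc => ?_
        simp only [Finset.mem_filter, Finset.mem_univ, true_and] at hc
        exact hdouble c hc
      omega
  -- the submatrix is the identity, so the rank is at least its size
  set M := Matrix.of fun (a : Fin k ↪ Fin (k + l)) (b : Fin l ↪ Fin (k + l)) =>
    MvPolynomial.coeff ((∑ t : Fin k, Finsupp.single (Fin.castAdd l t, a t) 1) +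
      ∑ t : Fin l, Finsupp.single (Fin.natAdd k t, b t) 1) P with hM
  have hsub : M.submatrix rowSel colSel = (1 : Matrix (Fᶜ.powersetCard m) (Fᶜ.powersetCard m) ℂ) := by
    ext B B'
    rw [Matrix.submatrix_apply, hM, Matrix.of_apply, entry, Matrix.one_apply]
  calc (l + m).choose m = Fintype.card (Fᶜ.powersetCard m) := by
        rw [Fintype.card_coe, Finset.card_powersetCard, hG]
    _ = (1 : Matrix (Fᶜ.powersetCard m) (Fᶜ.powersetCard m) ℂ).rank := (Matrix.rank_one).symm
    _ = (M.submatrix rowSel colSel).rank := by rw [hsub]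
    _ ≤ M.rank := Matrix.rank_submatrix_le _ _ _

end Summit.ValiantsHypothesis.ValiantsHypothesis.Theorems
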